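import Summits.CriticalPhenomena.PercolationContinuityZ3.Theorems.SahiAEBandPrelim

/-!
# Patched functions on rational boxes and the boxed orthant versions (band theorem, local step)

Support file of the Sahi cell (`prim-sahi`, typer seat, generation 24; `--supports stmt-CriticalPhenomena-4575`).
Small definitions (`ratLo`, `ratHi`, `IsPatchFn`, `patch`, `GenAt`, `PairGenAt`), theorems otherwise; no named
facts, no sorries.

Fix a measurable `φ : ℝ^ι → ℝ`.  For a pair `j = (k, k')` of rational vectors let `K_j = [k, k']` be the closed
rational box.  A **patch function** for `j` is a Borel `g`, supermodular at EVERY pair of `ℝ^ι`, with `g = φ` almost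
everywhere on `K_j` (`IsPatchFn`); the **patched function** `patch φ j` is `φ` on `K_j` and such a `g` elsewhere
(the zero function if no patch function exists).  In either case `patch φ j` is almost everywhere equal to an
everywhere-supermodular function, hence supermodular on almost every pair of `ℝ^ι` (`ae_supermodular_patch`), so the
WHOLE orthant machinery of generation 23 applies to it: generic base points (`GenAt`, `ae_genAt_patch`) and generic
pairs of base points (`PairGenAt`, `ae_pairGenAt_patch`) exist almost everywhere, simultaneously for all `j`
(countably many).  If `φ` is supermodular on almost every pair of an open set `B ⊇ K_j` then a patch function exists
(`exists_isPatchFn`, from `exists_supermodular_clampExtension_of_box` and a rational thickening,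
`exists_rat_box_between`).

By LOCALITY (`SahiAEBandPrelim.lean`) the boxed version `boxVersion φ c p` coincides with the orthant version of
`patch φ j` at `p` whenever `[c, p] ⊆ K_j`; consequently, above a base point `c` generic for `patch φ j`:
* `boxVersion_add_le` — `boxVersion φ c` is supermodular at every pair `p, q > c` with `[c, p ∨ q] ⊆ K_j`;
* `boxVersion_ae_eq` — `boxVersion φ c = φ` almost everywhere on `{x > c, [c, x] ⊆ K_j}`;
* `boxVersion_shift` — for a generic pair `c' < c`: `boxVersion φ c' p = boxVersion φ c p + N(p)` with the base
  correction `N` of `patch φ j` (`SahiAEOrthantShift.lean`), whenever `[c', p] ⊆ K_j`.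

No sorries, no new axioms.
-/

noncomputable section

namespace Summit.CriticalPhenomena.PercolationContinuityZ3.Theorems.SahiAEFourFunctions

open MeasureTheory Set Filter Topology Function
open scoped ENNReal NNReal

variable {ι : Type*} [Fintype ι] [DecidableEq ι]

/-! ### Rational boxes and thickenings -/

omit [Fintype ι] [DecidableEq ι] in
/-- Lower corner of the rational box `j`. [folklore] -/
def ratLo (j : (ι → ℚ) × (ι → ℚ)) : ι → ℝ := fun i => (j.1 i : ℝ)

omit [Fintype ι] [DecidableEq ι] in
/-- Upper corner of the rational box `j`. [folklore] -/
def ratHi (j : (ι → ℚ) × (ι → ℚ)) : ι → ℝ := fun i => (j.2 i : ℝ)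

omit [DecidableEq ι] in
/-- **Rational thickening**: a closed box inside an open set lies in the interior of a closed RATIONAL box inside the
open set (compactness, `IsCompact.exists_cthickening_subset_open`, sup metric). [folklore] -/
theorem exists_rat_box_between {B : Set (ι → ℝ)} (hB : IsOpen B) {c p : ι → ℝ} (hcp : c ≤ p) (h : Icc c p ⊆ B) :
    ∃ j : (ι → ℚ) × (ι → ℚ), (∀ i, ratLo j i < c i) ∧ (∀ i, p i < ratHi j i) ∧ Icc (ratLo j) (ratHi j) ⊆ B := by
  obtain ⟨δ, hδ, hsub⟩ := (isCompact_Icc (a := c) (b := p)).exists_cthickening_subset_open hB h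
  have hk : ∀ i, ∃ q : ℚ, c i - δ < q ∧ (q : ℝ) < c i := fun i => exists_rat_btwn (by linarith)
  have hk' : ∀ i, ∃ q : ℚ, p i < q ∧ (q : ℝ) < p i + δ := fun i => exists_rat_btwn (by linarith)
  choose k hk1 hk2 using hk
  choose k' hk'1 hk'2 using hk'
  refine ⟨(k, k'), fun i => hk2 i, fun i => hk'1 i, fun x hx => hsub ?_⟩
  have hy : (x ⊔ c) ⊓ p ∈ Icc c p := clamp_mem_Icc hcp x
  refine Metric.mem_cthickening_of_dist_le x ((x ⊔ c) ⊓ p) δ (Icc c p) hy ?_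
  refine (dist_pi_le_iff hδ.le).2 fun i => ?_
  rw [Real.dist_eq, abs_le]
  have h1 : (ratLo (k, k') i) ≤ x i := hx.1 i
  have h2 : x i ≤ ratHi (k, k') i := hx.2 i
  simp only [ratLo, ratHi] at h1 h2
  simp only [Pi.inf_apply, Pi.sup_apply]
  have := hk1 i; have := hk'2 i
  constructor
  · rcases le_total (x i) (c i) with hxc | hxc
    · rw [max_eq_right hxc, min_eq_left (hcp i)]; linarith
    · rw [max_eq_left hxc]
      rcases le_total (x i) (p i) with hxp | hxp
      · rw [min_eq_left hxp]; linarith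
      · rw [min_eq_right hxp]; linarith
  · rcases le_total (x i) (c i) with hxc | hxc
    · rw [max_eq_right hxc, min_eq_left (hcp i)]; linarith
    · rw [max_eq_left hxc]
      rcases le_total (x i) (p i) with hxp | hxp
      · rw [min_eq_left hxp]; linarith
      · rw [min_eq_right hxp]; linarith

/-! ### Patch functions and patched functions -/

omit [DecidableEq ι] in
/-- **A patch function** for `φ` on the rational box `K_j`: Borel, supermodular at every pair of `ℝ^ι`, and `= φ`
almost everywhere on `K_j`. [this work] -/
def IsPatchFn (φ : (ι → ℝ) → ℝ) (j : (ι → ℚ) × (ι → ℚ)) (g : (ι → ℝ) → ℝ) : Prop :=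
  Measurable g ∧ (∀ x y, g x + g y ≤ g (x ⊓ y) + g (x ⊔ y)) ∧
    ∀ᵐ x ∂(volume : Measure (ι → ℝ)), x ∈ Icc (ratLo j) (ratHi j) → g x = φ x

open Classical in
omit [DecidableEq ι] in
/-- **The patched function**: `φ` on `K_j`, a patch function elsewhere (the zero function if none exists).
[this work] -/
def patch (φ : (ι → ℝ) → ℝ) (j : (ι → ℚ) × (ι → ℚ)) : (ι → ℝ) → ℝ :=
  if h : ∃ g, IsPatchFn φ j g then (Icc (ratLo j) (ratHi j)).piecewise φ (Classical.choose h) else fun _ => 0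

omit [DecidableEq ι] in
/-- On its box the patched function is `φ` (when a patch function exists). [this work] -/
theorem patch_eq_of_mem {φ : (ι → ℝ) → ℝ} {j : (ι → ℚ) × (ι → ℚ)} (h : ∃ g, IsPatchFn φ j g) {x : ι → ℝ}
    (hx : x ∈ Icc (ratLo j) (ratHi j)) : patch φ j x = φ x := by
  classical
  simp only [patch, dif_pos h, Set.piecewise_eq_of_mem _ _ _ hx]

omit [DecidableEq ι] in
/-- **The patched function is Borel and almost everywhere equal to an everywhere-supermodular function.**
[this work] -/
theorem patch_spec {φ : (ι → ℝ) → ℝ} (hφ : Measurable φ) (j : (ι → ℚ) × (ι → ℚ)) :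
    Measurable (patch φ j) ∧ ∃ g : (ι → ℝ) → ℝ, (∀ x y, g x + g y ≤ g (x ⊓ y) + g (x ⊔ y)) ∧
      patch φ j =ᵐ[(volume : Measure (ι → ℝ))] g := by
  classical
  by_cases h : ∃ g, IsPatchFn φ j g
  · obtain ⟨hgm, hgsm, hgae⟩ := Classical.choose_spec h
    have e : patch φ j = (Icc (ratLo j) (ratHi j)).piecewise φ (Classical.choose h) := by
      simp only [patch, dif_pos h]
    rw [e]
    refine ⟨hφ.piecewise measurableSet_Icc hgm, Classical.choose h, hgsm, ?_⟩
    filter_upwards [hgae] with x hx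
    by_cases hxK : x ∈ Icc (ratLo j) (ratHi j)
    · rw [Set.piecewise_eq_of_mem _ _ _ hxK, hx hxK]
    · rw [Set.piecewise_eq_of_notMem _ _ _ hxK]
  · have e : patch φ j = fun _ => 0 := by simp only [patch, dif_neg h]
    rw [e]
    exact ⟨measurable_const, fun _ => 0, fun _ _ => by simp, Eventually.of_forall fun _ => rfl⟩

omit [DecidableEq ι] in
/-- The patched function is measurable. [folklore] -/
theorem measurable_patch {φ : (ι → ℝ) → ℝ} (hφ : Measurable φ) (j : (ι → ℚ) × (ι → ℚ)) :
    Measurable (patch φ j) := (patch_spec hφ j).1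

omit [DecidableEq ι] in
/-- **The patched function is supermodular on almost every pair of `ℝ^ι`.** [this work] -/
theorem ae_supermodular_patch {φ : (ι → ℝ) → ℝ} (hφ : Measurable φ) (j : (ι → ℚ) × (ι → ℚ)) :
    ∀ᵐ p ∂(volume : Measure (ι → ℝ)).prod volume,
      patch φ j p.1 + patch φ j p.2 ≤ patch φ j (p.1 ⊓ p.2) + patch φ j (p.1 ⊔ p.2) := by
  obtain ⟨-, g, hg, hae⟩ := patch_spec hφ j
  exact ae_supermodular_of_ae_eq hg hae

omit [DecidableEq ι] in
/-- **Existence of patch functions**: if `φ` is supermodular on almost every pair of an open set `B` containing the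
non-degenerate rational box `K_j`, a patch function exists (`exists_supermodular_clampExtension_of_box` on a
rational thickening). [this work] -/
theorem exists_isPatchFn {B : Set (ι → ℝ)} (hB : IsOpen B) {φ : (ι → ℝ) → ℝ} (hφ : Measurable φ)
    (hsmB : ∀ᵐ p ∂(volume : Measure (ι → ℝ)).prod volume,
      p.1 ∈ B → p.2 ∈ B → φ p.1 + φ p.2 ≤ φ (p.1 ⊓ p.2) + φ (p.1 ⊔ p.2))
    {j : (ι → ℚ) × (ι → ℚ)} (hj : ∀ i, ratLo j i < ratHi j i) (hjB : Icc (ratLo j) (ratHi j) ⊆ B) :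
    ∃ g, IsPatchFn φ j g := by
  obtain ⟨j', hlo, hhi, hj'B⟩ := exists_rat_box_between hB (fun i => (hj i).le) hjB
  set W : Set (ι → ℝ) := Set.pi univ fun i => Ioo (ratLo j' i) (ratHi j' i) with hW
  have mW : MeasurableSet W := MeasurableSet.univ_pi fun _ => measurableSet_Ioo
  have hWB : W ⊆ B := fun x hx => hj'B ⟨fun i => (Set.mem_univ_pi.1 hx i).1.le, fun i => (Set.mem_univ_pi.1 hx i).2.le⟩
  have hsmW : ∀ᵐ p : (ι → ℝ) × (ι → ℝ) ∂((volume : Measure (ι → ℝ)).restrict W).prod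
      ((volume : Measure (ι → ℝ)).restrict W), φ p.1 + φ p.2 ≤ φ (p.1 ⊓ p.2) + φ (p.1 ⊔ p.2) := by
    rw [Measure.prod_restrict]
    refine (ae_restrict_iff' (mW.prod mW)).2 ?_
    filter_upwards [hsmB] with p hp hpW
    exact hp (hWB hpW.1) (hWB hpW.2)
  obtain ⟨g, hgm, hgsm, hgae⟩ :=
    exists_supermodular_clampExtension_of_box hlo hj hhi φ hφ hsmW
  exact ⟨g, hgm, hgsm, hgae⟩

/-! ### Generic base points and generic pairs for the patched functions -/

/-- **Generic base point** for `ψ` (the hypothesis `hc` of `SahiAEOrthantVersion.lean`): supermodularity at the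
generic pairs `((c; i := s), x)`. [this work] -/
def GenAt (ψ : (ι → ℝ) → ℝ) (c : ι → ℝ) : Prop :=
  ∀ i, ∀ᵐ q ∂(volume : Measure (ι → ℝ)).prod (volume : Measure ℝ),
    ψ (update c i q.2) + ψ q.1 ≤ ψ (update c i q.2 ⊓ q.1) + ψ (update c i q.2 ⊔ q.1)

/-- **Generic pair of base points** for `ψ` (the hypothesis `hpair` of `SahiAEOrthantShift.lean`). [this work] -/
def PairGenAt (ψ : (ι → ℝ) → ℝ) (c c' : ι → ℝ) : Prop :=
  ∀ i, ∀ᵐ rt ∂(volume : Measure ℝ).prod (volume : Measure ℝ),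
    ψ (update c i rt.1) + ψ (update c' i rt.2) ≤
      ψ (update c i rt.1 ⊓ update c' i rt.2) + ψ (update c i rt.1 ⊔ update c' i rt.2)

omit [Fintype ι] in
/-- Generic pairs are symmetric. [folklore] -/
theorem PairGenAt.symm {ψ : (ι → ℝ) → ℝ} {c c' : ι → ℝ} (h : PairGenAt ψ c c') : PairGenAt ψ c' c := by
  intro i
  have hsw := (Measure.measurePreserving_swap (μ := (volume : Measure ℝ))
    (ν := (volume : Measure ℝ))).quasiMeasurePreserving.ae (h i)
  filter_upwards [hsw] with rt hrt
  simp only [Prod.fst_swap, Prod.snd_swap] at hrt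
  rw [inf_comm, sup_comm]
  linarith

/-- **Almost every base point is generic for every patched function.** [this work] -/
theorem ae_genAt_patch {φ : (ι → ℝ) → ℝ} (hφ : Measurable φ) :
    ∀ᵐ c ∂(volume : Measure (ι → ℝ)), ∀ j : (ι → ℚ) × (ι → ℚ), GenAt (patch φ j) c := by
  rw [ae_all_iff]
  exact fun j => ae_generic_base (ae_supermodular_patch hφ j)

/-- **Almost every pair of base points is generic for every patched function.** [this work] -/
theorem ae_pairGenAt_patch {φ : (ι → ℝ) → ℝ} (hφ : Measurable φ) :
    ∀ᵐ c ∂(volume : Measure (ι → ℝ)), ∀ j : (ι → ℚ) × (ι → ℚ),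
      ∀ᵐ c' ∂(volume : Measure (ι → ℝ)), PairGenAt (patch φ j) c c' := by
  rw [ae_all_iff]
  exact fun j => ae_pair_generic (ae_supermodular_patch hφ j)

/-! ### The boxed version above a generic base point -/

/-- **Supermodularity of the boxed version**: at every pair `p, q > c` with `[c, p ∨ q] ⊆ K_j`, for `c` generic for
`patch φ j`. [this work] -/
theorem boxVersion_add_le {φ : (ι → ℝ) → ℝ} (hφ : Measurable φ) {j : (ι → ℚ) × (ι → ℚ)}
    (hj : ∃ g, IsPatchFn φ j g) {c : ι → ℝ} (hc : GenAt (patch φ j) c) {p q : ι → ℝ}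
    (hp : ∀ i, c i < p i) (hq : ∀ i, c i < q i) (hK : Icc c (p ⊔ q) ⊆ Icc (ratLo j) (ratHi j)) :
    boxVersion φ c p + boxVersion φ c q ≤ boxVersion φ c (p ⊓ q) + boxVersion φ c (p ⊔ q) := by
  have hpO : p ∈ Set.pi univ fun i => Ioi (c i) := mem_orthant_iff.2 hp
  have hqO : q ∈ Set.pi univ fun i => Ioi (c i) := mem_orthant_iff.2 hq
  have h := (orthantVersion_spec (measurable_patch hφ j) (ae_supermodular_patch hφ j) hc).2 p hpO q hqO
  have hcp : c ≤ p := fun i => (hp i).le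
  have hcq : c ≤ q := fun i => (hq i).le
  have eq : ∀ {x : ι → ℝ}, c ≤ x → x ≤ p ⊔ q → orthantVersion (patch φ j) c x = boxVersion φ c x :=
    fun hcx hx => orthantVersion_eq_boxVersion hcx fun y hy => patch_eq_of_mem hj (hK ⟨hy.1, hy.2.trans hx⟩)
  rwa [eq hcp le_sup_left, eq hcq le_sup_right, eq (le_inf hcp hcq) (inf_le_left.trans le_sup_left),
    eq (hcp.trans le_sup_left) le_rfl] at h

/-- **The boxed version is a version**: `boxVersion φ c = φ` almost everywhere on `{x > c, [c, x] ⊆ K_j}`.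
[this work] -/
theorem boxVersion_ae_eq {φ : (ι → ℝ) → ℝ} (hφ : Measurable φ) {j : (ι → ℚ) × (ι → ℚ)}
    (hj : ∃ g, IsPatchFn φ j g) {c : ι → ℝ} (hc : GenAt (patch φ j) c) :
    ∀ᵐ x ∂(volume : Measure (ι → ℝ)), (∀ i, c i < x i) → Icc c x ⊆ Icc (ratLo j) (ratHi j) →
      boxVersion φ c x = φ x := by
  filter_upwards [(orthantVersion_spec (measurable_patch hφ j) (ae_supermodular_patch hφ j) hc).1] with x hx hcx hK
  have hxO : x ∈ Set.pi univ fun i => Ioi (c i) := mem_orthant_iff.2 hcx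
  rw [← orthantVersion_eq_boxVersion (fun i => (hcx i).le) fun y hy => patch_eq_of_mem hj (hK hy), hx hxO,
    patch_eq_of_mem hj (hK ⟨fun i => (hcx i).le, le_rfl⟩)]

/-- **Shift of the boxed versions** between a generic pair of base points `c' < c`: the difference is the base
correction of the patched function (`orthantVersion_shift`), whenever `[c', p] ⊆ K_j`. [this work] -/
theorem boxVersion_shift {φ : (ι → ℝ) → ℝ} (hφ : Measurable φ) {j : (ι → ℚ) × (ι → ℚ)}
    (hj : ∃ g, IsPatchFn φ j g) {c c' : ι → ℝ} (hlt : ∀ i, c' i < c i) (hc : GenAt (patch φ j) c)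
    (hcc' : PairGenAt (patch φ j) c c') {p : ι → ℝ} (hp : ∀ i, c i < p i)
    (hK : Icc c' p ⊆ Icc (ratLo j) (ratHi j)) :
    boxVersion φ c' p = boxVersion φ c p + baseCorrection (patch φ j) c c' p := by
  have hpO : p ∈ Set.pi univ fun i => Ioi (c i) := mem_orthant_iff.2 hp
  have h := orthantVersion_shift (measurable_patch hφ j) hlt hc hcc' hpO
  have hcp : c ≤ p := fun i => (hp i).le
  have hc'p : c' ≤ p := fun i => ((hlt i).trans (hp i)).le
  rwa [orthantVersion_eq_boxVersion hc'p fun y hy => patch_eq_of_mem hj (hK hy),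
    orthantVersion_eq_boxVersion hcp fun y hy => patch_eq_of_mem hj (hK ⟨fun i => (hlt i).le.trans (hy.1 i), hy.2⟩)]
    at h

end Summit.CriticalPhenomena.PercolationContinuityZ3.Theorems.SahiAEFourFunctions
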